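import Literature.IUT.HodgeArakelov.ModelMonoThetaModulesLim
import Literature.IUT.HodgeArakelov.ModelMonoThetaBaseDatumModN

/-!
# [IUTchII] Cor. 1.10 at the GENUINE natural system, II: the base datum `((l·Δ_Θ)(𝕄_*), Π_μ(𝕄_*), (∗mono-Θ))` at
# `Π₀ := Π^tp_{X̲̲}` with its `Aut(Π^tp_{X̲̲})`-action, the functorial family, and the junction C110-S10 (`Models`)

S. Mochizuki, *Inter-universal Teichmüller theory II*, §1, Cor. 1.10, kurims p. 47 l. 7–19 (VERBATIM, own fetch
paper:url-5036b4059555 p0047): "Consider the cyclotomic rigidity isomorphism `(l·Δ_Θ)(Π) ⥲ Π_μ(M^Θ_*(Π))` (∗mono-Θ_Π) [where we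
identify `(l·Δ_Θ)(M^Θ_*(Π))` with `(l·Δ_Θ)(Π)` — cf. Proposition 1.4] obtained by composing the functorial algorithm `Π ↦ M^Θ_*(Π)`
of Proposition 1.2, (i) [cf. also Proposition 1.5, (i)], with the functorial algorithm for constructing a cyclotomic rigidity
isomorphism of Proposition 1.5, (iii). Then the data consisting of the topological group `Π`, the topological `Π`-modules
constituted by the domain and codomain of (∗mono-Θ_Π), and the isomorphism (∗mono-Θ_Π) determines a functor `ℛ → ℱ` [i.e., where `ℱ`
denotes the category defined in the evident way so as to accommodate the data just listed] which arises from a functorial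
algorithm in the topological group `Π`; … In particular, the resulting natural functor `Ψ_ℛ : ℛ → ℛ†` [cf. Example 1.9, (i)] is
multiradially defined."
[claim: Mochizuki2012, status: disputed] (IUTchII §1 Cor 1.10, kurims p.47); [EtTh] Cor. 2.18 (i) p. 286 (PRIMS PDF p. 60),
Cor. 2.18 (iv) p. 287 (PDF p. 61), Cor. 2.19 (i) p. 290 (PDF p. 64) [cite: MochizukiEtTh2009, Cor 2.19(i) p.64].

abc-iut cell (WAVE-4 seat abc-iut-w4-d038, gen 2), sub-DAG `plan/L6/SUBDAG-IUTchII-Cor-110.md` row **C110-S10** at the GENUINE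
natural system (abc-iut-w4-d030's `EtaleLevels.modelSystem` / `thetaEnvData` / `bijective_rigidLimHom`, p414139 / p415224 /
p416249). abc-iut-w5-d145 built the MOD-`N` MODEL instance (`ModelCyclotomes.baseDatumModN`, p416119, rows S10a–S10d) and left
"the genuine (limit) instance = r6/S8 + `ρ_B` at the limit" OPEN; part I (`ModelMonoThetaModulesLim.lean`) supplies S8. DATA
definitions (no `Prop`-valued definition, no new named fact), every law PROVED:
* `EtaleLevels.rhoALim γ` — the automorphism of `(l·Δ_Θ)(𝕄_*) = (l·Δ_Θ)/thetaKer` induced by `γ ∈ Aut(Π^tp_{X̲̲})` (abc-iut-w5-d145's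
  `SubquotientKit.autQuot` at the clauses «`γ` preserves `thetaKer` and the inverse image of `l·Δ_Θ`» of [EtTh] Cor. 2.18 (i),
  `RigidData.Cor218_i` at level `1`, BY NAME); functorial, `γ`-semilinear; `intCompat_rhoALim` — through `intCompat M` it IS
  d145's mod-`M` `ρ_A` (`rhoModN`);
* `EtaleLevels.rhoBLim γ` — its transport through (∗mono-Θ); **`rhoBLim_level`** — it acts on EVERY level `Π_μ(𝕄_M) = μ_M` by d145's
  coefficient automorphism `γ̄_μ = ModelCyclotomes.coeffAut` of that level, hence (`rhoBLim_level_eq_iso`, via d145's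
  `iso_inMu_eq_coeffAut'` = [EtTh] Cor. 2.19 (i) at the model) by the action on `μ_M` of EVERY automorphism of the level-`M` model
  mono-theta environment over `γ` ([EtTh] Cor. 2.18 (iv)) — so `ρ_B` is the printed lift action, not an arbitrary transport;
* **`EtaleLevels.baseDatumLim : MonoThetaBaseDatum S Π₀`** (all laws PROVED), `familyLim` (`MonoThetaBaseDatum.family`, p415127),
  `cor110_multiradiallyDefined_modelLim` — [IUTchII] Cor. 1.10's functorial family and its printed conclusion ("`Ψ_ℛ : ℛ → ℛ†` is
  multiradially defined") AT THE GENUINE NATURAL SYSTEM, modulo [EtTh] Cor. 2.18 (i) BY NAME;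
* **`EtaleLevels.familyLim_models`** — the JUNCTION C110-S10: `familyLim.Models (thetaEnvData …) moduleStrLim`
  (`MonoThetaBaseDatum.family_models` with the IDENTITY identifications — the base datum IS the genuine output), i.e. the
  functorial family EXTENDS `((l·Δ_Θ)(𝕄_*), Π_μ(𝕄_*), rigidLim)` of Props. 1.4 / 1.5 (iii); `familyLim_models_of_cor218_i` — with the
  `Π^tp_{Ÿ}`-clause input derived from Cor. 2.18 (i) (abc-iut-w4-d013), so the junction holds modulo ONE named level fact
  (`RigidData.Cor218_i`, F-0620 class) and the natural system's data (`Prop15iii`, `CuspLabels`, `hZ` = G-w4d021-1).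
HONEST FRAMING: constructions over the cell's own [EtTh]-side objects plus one named [EtTh] statement as hypothesis; the
[IUTchII] side is the claim key `Mochizuki2012` (DISPUTED, D-0012) and nothing disputed is asserted; no side is taken on
[IUTchIII] Cor. 3.12; typed ≠ discharged.
v2 (doc-only, referee lane O finding O14-F1, 2026-08-26): the header quotation of Cor. 1.10 is now VERBATIM (v1 paraphrased the
«obtained by composing …» clause inside quotation marks); no declaration changed.
-/

noncomputable section

namespace Literature.IUT.HodgeArakelov

open CategoryTheory Literature.AnabelianGeometry.EtaleTheta Literature.AnabelianGeometry.SemiGraphs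
open scoped Literature.AnabelianGeometry.EtaleTheta

namespace EtaleLevels

variable {p : ℕ} [Fact p.Prime] {D : Literature.AnabelianGeometry.EtaleTheta.ThetaSetting p}
  {E : D.EtaleThetaData} {l : ℕ} (C : E.DoubleUnderline l) (hC : D.Compat) (hS : D.Sec2Hyps)
  (hl : l.Prime) (hp2 : p ≠ 2) (hpl : p ≠ l) (hζ : ∃ ζ : D.K, IsPrimitiveRoot ζ (4 * l))
  (mods : ∀ M : ℕ+, D.CyclotomeMod l M)
  (f : contCocycles D.toTheta D.DeltaTheta C.GtpYdduu) (hf : f ∈ C.rootCocycles hC)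
  (hmods : ∀ (M M' : ℕ+) (h : (M : ℕ) ∣ (M' : ℕ)) (x : D.lDeltaTheta l),
    MuN.red p M M' h ((mods M').red x) = (mods M).red x)
  (h15 : Literature.AnabelianGeometry.EtaleTheta.ThetaSetting.Prop15iii E hC) (L : C.CuspLabels)
  (hZ : ∀ M : ℕ+, Nonempty (ModelCyclotomes.lDeltaQuot (C.rigidData (mods M) hC hS h15 L) ≃*
    Literature.IUT.HodgeTheaters.ZHat))
  (hcharY : EtaleThetaDataOfSetting.PiYddCharacteristic C)

/-! ## `ρ_A` and `ρ_B` at the limit ([EtTh] Cor. 2.18 (i) / 2.19 (i)) -/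

section Rho

variable (h218i₁ : (levelRigid C hC hS mods h15 L 1).Cor218_i)

/-- **`ρ_A(γ)` at the genuine natural system**: the automorphism of `(l·Δ_Θ)(𝕄_*) = (l·Δ_Θ)/thetaKer` induced by a topological
automorphism `γ` of `Π^tp_{X̲̲}` — abc-iut-w5-d145's `SubquotientKit.autQuot` at the clauses «`γ` preserves `thetaKer` and the
inverse image of `l·Δ_Θ`» of the named fact [EtTh] Cor. 2.18 (i) (`RigidData.Cor218_i`, read at level `1`; the two subgroups
do not depend on the level). [cite: MochizukiEtTh2009, Cor 2.18(i) p.60] -/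
def rhoALim (γ : (levelRigid C hC hS mods h15 L 1).PiX ≃ₜ* (levelRigid C hC hS mods h15 L 1).PiX) :
    (EtaleThetaDataOfSetting.lDeltaSubquotient C).carrier ≃* (EtaleThetaDataOfSetting.lDeltaSubquotient C).carrier :=
  SubquotientKit.autQuot (levelRigid C hC hS mods h15 L 1).lDeltaTheta (levelRigid C hC hS mods h15 L 1).thetaKer
    γ.toMulEquiv (h218i₁ γ).2.2.2.2.1 (h218i₁ γ).2.2.2.1

/-- `ρ_A(γ)` on the class of `g`: the class of `γ g`. [cite: MochizukiEtTh2009, Cor 2.18(i) p.60] -/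
theorem rhoALim_mk (γ : (levelRigid C hC hS mods h15 L 1).PiX ≃ₜ* (levelRigid C hC hS mods h15 L 1).PiX)
    (g : ↥(levelRigid C hC hS mods h15 L 1).lDeltaTheta) :
    rhoALim C hC hS mods h15 L h218i₁ γ (QuotientGroup.mk g) =
      QuotientGroup.mk (SubquotientKit.restrictEquiv γ.toMulEquiv (h218i₁ γ).2.2.2.2.1 g) :=
  SubquotientKit.autQuot_mk _ _ _ _ _ g

/-- `ρ_A(id) = id` (PROVED). [claim: Mochizuki2012, status: disputed] (IUTchII §1 Cor 1.10, kurims p.47) -/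
theorem rhoALim_refl : rhoALim C hC hS mods h15 L h218i₁ (ContinuousMulEquiv.refl _) = MulEquiv.refl _ :=
  SubquotientKit.autQuot_refl _ _ _ _

/-- `ρ_A(γ ≫ δ) = ρ_A(γ) ≫ ρ_A(δ)` (PROVED). [claim: Mochizuki2012, status: disputed] (IUTchII §1 Cor 1.10, kurims p.47) -/
theorem rhoALim_trans (γ δ : (levelRigid C hC hS mods h15 L 1).PiX ≃ₜ* (levelRigid C hC hS mods h15 L 1).PiX) :
    rhoALim C hC hS mods h15 L h218i₁ (γ.trans δ) =
      (rhoALim C hC hS mods h15 L h218i₁ γ).trans (rhoALim C hC hS mods h15 L h218i₁ δ) :=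
  SubquotientKit.autQuot_trans _ _ γ.toMulEquiv δ.toMulEquiv _ _ _ _ _ _

/-- **`ρ_A(γ)` is `γ`-semilinear** for the conjugation action (`rhoA_act`, PROVED: abc-iut-w5-d145's `autQuot_conjQuot`).
[claim: Mochizuki2012, status: disputed] (IUTchII §1 Cor 1.10, kurims p.47) -/
theorem rhoALim_actIntLim (γ : (levelRigid C hC hS mods h15 L 1).PiX ≃ₜ* (levelRigid C hC hS mods h15 L 1).PiX)
    (x : ↥C.Huu) (a : (EtaleThetaDataOfSetting.lDeltaSubquotient C).carrier) :
    rhoALim C hC hS mods h15 L h218i₁ γ (actIntLim C hC hS mods h15 L x a) =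
      actIntLim C hC hS mods h15 L (γ x) (rhoALim C hC hS mods h15 L h218i₁ γ a) :=
  SubquotientKit.autQuot_conjQuot (levelRigid C hC hS mods h15 L 1).lDeltaTheta (levelRigid C hC hS mods h15 L 1).thetaKer
    γ.toMulEquiv _ _ x a

/-- **Through `intCompat M`, `ρ_A(γ)` IS abc-iut-w5-d145's mod-`M` `ρ_A` (`ModelCyclotomes.rhoModN`) of the level-`M` model**, for
[EtTh] Cor. 2.18 (i) granted at level `M` as well (the two inputs define the same map: the clauses concern the same
subgroups of `Π^tp_{X̲̲}`). [claim: Mochizuki2012, status: disputed] (IUTchII §1 Cor 1.10, kurims p.47) -/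
theorem intCompat_rhoALim (M : ℕ+) (h218iM : (levelRigid C hC hS mods h15 L M).Cor218_i)
    (γ : (levelRigid C hC hS mods h15 L 1).PiX ≃ₜ* (levelRigid C hC hS mods h15 L 1).PiX)
    (a : (EtaleThetaDataOfSetting.lDeltaSubquotient C).carrier) :
    intCompat C hC hS mods h15 L M (rhoALim C hC hS mods h15 L h218i₁ γ a) =
      ModelCyclotomes.rhoModN (S := levelSetting C hC hS hl hp2 hpl hζ mods f hf M) (levelRigid C hC hS mods h15 L M)
        h218iM γ (intCompat C hC hS mods h15 L M a) := by
  induction a using QuotientGroup.induction_on with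
  | H g =>
    change (QuotientGroup.mk ((ModelCyclotomes.intCycEquiv (levelRigid C hC hS mods h15 L M)).symm
        (rhoALim C hC hS mods h15 L h218i₁ γ (QuotientGroup.mk g))) : ModPow _ (M : ℕ)) =
      ModelCyclotomes.rhoModN (S := levelSetting C hC hS hl hp2 hpl hζ mods f hf M) (levelRigid C hC hS mods h15 L M)
        h218iM γ (QuotientGroup.mk ((ModelCyclotomes.intCycEquiv (levelRigid C hC hS mods h15 L M)).symm
          (QuotientGroup.mk g)))
    rw [ModelCyclotomes.rhoModN_mk]
    rfl

/-- **`ρ_B(γ)` at the genuine natural system**: the automorphism of `Π_μ(𝕄_*)` induced by `γ` — DEFINED as the transport of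
`ρ_A(γ)` through (∗mono-Θ) and PROVED below (`rhoBLim_level`) to act on each level `Π_μ(𝕄_M) = μ_M` by abc-iut-w5-d145's
coefficient automorphism `γ̄_μ` of that level, hence (S10c) by every automorphism of the model mono-theta environment over
`γ` ([EtTh] Cor. 2.18 (iv) / 2.19 (i)). [cite: MochizukiEtTh2009, Cor 2.19(i) p.64] -/
def rhoBLim (γ : (levelRigid C hC hS mods h15 L 1).PiX ≃ₜ* (levelRigid C hC hS mods h15 L 1).PiX) :
    ↥(modelSystem C hC hS hl hp2 hpl hζ mods f hf hmods h15 L hZ).extCycLim ≃*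
      ↥(modelSystem C hC hS hl hp2 hpl hζ mods f hf hmods h15 L hZ).extCycLim :=
  (rigidLimEquiv C hC hS hl hp2 hpl hζ mods f hf hmods h15 L hZ).symm.trans
    ((rhoALim C hC hS mods h15 L h218i₁ γ).trans (rigidLimEquiv C hC hS hl hp2 hpl hζ mods f hf hmods h15 L hZ))

/-- `ρ_B(γ) = (∗mono-Θ) ∘ ρ_A(γ) ∘ (∗mono-Θ)⁻¹` on elements. [cite: MochizukiEtTh2009, Cor 2.19(i) p.64] -/
theorem rhoBLim_apply (γ : (levelRigid C hC hS mods h15 L 1).PiX ≃ₜ* (levelRigid C hC hS mods h15 L 1).PiX)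
    (y : ↥(modelSystem C hC hS hl hp2 hpl hζ mods f hf hmods h15 L hZ).extCycLim) :
    rhoBLim C hC hS hl hp2 hpl hζ mods f hf hmods h15 L hZ h218i₁ γ y =
      rigidLimEquiv C hC hS hl hp2 hpl hζ mods f hf hmods h15 L hZ
        (rhoALim C hC hS mods h15 L h218i₁ γ ((rigidLimEquiv C hC hS hl hp2 hpl hζ mods f hf hmods h15 L hZ).symm y)) :=
  rfl

/-- `ρ_B(γ) ((∗mono-Θ) a) = (∗mono-Θ) (ρ_A(γ) a)` (`rho_comm`). [cite: MochizukiEtTh2009, Cor 2.19(i) p.64] -/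
theorem rhoBLim_rigidLimEquiv (γ : (levelRigid C hC hS mods h15 L 1).PiX ≃ₜ* (levelRigid C hC hS mods h15 L 1).PiX)
    (a : (EtaleThetaDataOfSetting.lDeltaSubquotient C).carrier) :
    rhoBLim C hC hS hl hp2 hpl hζ mods f hf hmods h15 L hZ h218i₁ γ
        (rigidLimEquiv C hC hS hl hp2 hpl hζ mods f hf hmods h15 L hZ a) =
      rigidLimEquiv C hC hS hl hp2 hpl hζ mods f hf hmods h15 L hZ (rhoALim C hC hS mods h15 L h218i₁ γ a) := by
  rw [rhoBLim_apply, MulEquiv.symm_apply_apply]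

/-- `ρ_B(id) = id` (PROVED). [claim: Mochizuki2012, status: disputed] (IUTchII §1 Cor 1.10, kurims p.47) -/
theorem rhoBLim_refl : rhoBLim C hC hS hl hp2 hpl hζ mods f hf hmods h15 L hZ h218i₁ (ContinuousMulEquiv.refl _) =
    MulEquiv.refl _ := by
  refine MulEquiv.ext fun y => ?_
  rw [rhoBLim_apply, rhoALim_refl, MulEquiv.refl_apply, MulEquiv.apply_symm_apply, MulEquiv.refl_apply]

/-- `ρ_B(γ ≫ δ) = ρ_B(γ) ≫ ρ_B(δ)` (PROVED). [claim: Mochizuki2012, status: disputed] (IUTchII §1 Cor 1.10, kurims p.47) -/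
theorem rhoBLim_trans (γ δ : (levelRigid C hC hS mods h15 L 1).PiX ≃ₜ* (levelRigid C hC hS mods h15 L 1).PiX) :
    rhoBLim C hC hS hl hp2 hpl hζ mods f hf hmods h15 L hZ h218i₁ (γ.trans δ) =
      (rhoBLim C hC hS hl hp2 hpl hζ mods f hf hmods h15 L hZ h218i₁ γ).trans
        (rhoBLim C hC hS hl hp2 hpl hζ mods f hf hmods h15 L hZ h218i₁ δ) := by
  refine MulEquiv.ext fun y => ?_
  rw [MulEquiv.trans_apply, rhoBLim_apply, rhoBLim_apply, rhoBLim_apply, rhoALim_trans, MulEquiv.trans_apply,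
    MulEquiv.symm_apply_apply]

/-- **`ρ_B(γ)` is `γ`-semilinear** (`rhoB_act`, PROVED). [claim: Mochizuki2012, status: disputed] (IUTchII §1 Cor 1.10, kurims p.47) -/
theorem rhoBLim_actExtLim (γ : (levelRigid C hC hS mods h15 L 1).PiX ≃ₜ* (levelRigid C hC hS mods h15 L 1).PiX)
    (x : ↥C.Huu) (y : ↥(modelSystem C hC hS hl hp2 hpl hζ mods f hf hmods h15 L hZ).extCycLim) :
    rhoBLim C hC hS hl hp2 hpl hζ mods f hf hmods h15 L hZ h218i₁ γ
        (actExtLim C hC hS hl hp2 hpl hζ mods f hf hmods h15 L hZ x y) =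
      actExtLim C hC hS hl hp2 hpl hζ mods f hf hmods h15 L hZ (γ x)
        (rhoBLim C hC hS hl hp2 hpl hζ mods f hf hmods h15 L hZ h218i₁ γ y) := by
  rw [rhoBLim_apply, actExtLim_apply, actExtLim_apply, rhoBLim_apply, MulEquiv.symm_apply_apply,
    MulEquiv.symm_apply_apply, rhoALim_actIntLim]

/-- **`ρ_B(γ)` acts on each level `Π_μ(𝕄_M) = μ_M ⊆ Π^tp_{Y̲̲}[μ_M]` by the COEFFICIENT AUTOMORPHISM `γ̄_μ` of that level**
(abc-iut-w5-d145's `ModelCyclotomes.coeffAut`, S10d; hence, by its `iso_inMu_eq_coeffAut'` = [EtTh] Cor. 2.19 (i) at the model,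
by the action on `μ_M` of EVERY automorphism of the level-`M` model mono-theta environment lying over `γ`): if the
`M`-component of `y ∈ Π_μ(𝕄_*)` is `μ_M ∋ a ↪ Π^tp_{Y̲̲}[μ_M]`, that of `ρ_B(γ) y` is `γ̄_μ(a)`. PROVED — so `ρ_B` is the printed
[EtTh] Cor. 2.18 (iv) lift action, not an arbitrary transport. [cite: MochizukiEtTh2009, Cor 2.19(i) p.64] -/
theorem rhoBLim_level (M : ℕ+) (h218iM : (levelRigid C hC hS mods h15 L M).Cor218_i)
    (γ : (levelRigid C hC hS mods h15 L 1).PiX ≃ₜ* (levelRigid C hC hS mods h15 L 1).PiX)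
    (y : ↥(modelSystem C hC hS hl hp2 hpl hζ mods f hf hmods h15 L hZ).extCycLim) (a : (levelData C hC hS mods M).mu)
    (hy : (y : ∀ M', ((modelSystem C hC hS hl hp2 hpl hζ mods f hf hmods h15 L hZ).env M').Pi) M =
      (CycEnvelope.inMu (levelData C hC hS mods M).augY (levelData C hC hS mods M).chi a : (levelData C hC hS mods M).env)) :
    ((rhoBLim C hC hS hl hp2 hpl hζ mods f hf hmods h15 L hZ h218i₁ γ y :
        ↥(modelSystem C hC hS hl hp2 hpl hζ mods f hf hmods h15 L hZ).extCycLim) :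
        ∀ M', ((modelSystem C hC hS hl hp2 hpl hζ mods f hf hmods h15 L hZ).env M').Pi) M =
      (CycEnvelope.inMu (levelData C hC hS mods M).augY (levelData C hC hS mods M).chi
        (ModelCyclotomes.coeffAut (S := levelSetting C hC hS hl hp2 hpl hζ mods f hf M) (levelRigid C hC hS mods h15 L M)
          h218iM γ a) : (levelData C hC hS mods M).env) := by
  obtain ⟨b, rfl⟩ := (rigidLimEquiv C hC hS hl hp2 hpl hζ mods f hf hmods h15 L hZ).surjective y
  -- the `M`-component of `(∗mono-Θ) b` is `inMu (intModEquiv (intCompat M b))`, so `a = intModEquiv (intCompat M b)`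
  have hb : (CycEnvelope.inMu (levelData C hC hS mods M).augY (levelData C hC hS mods M).chi
      (ModelCyclotomes.intModEquiv (levelRigid C hC hS mods h15 L M) (intCompat C hC hS mods h15 L M b)) :
        (levelData C hC hS mods M).env) =
      CycEnvelope.inMu (levelData C hC hS mods M).augY (levelData C hC hS mods M).chi a := by
    rw [← hy]
    exact (coe_rigid_iso C hC hS hl hp2 hpl hζ mods f hf h15 L hZ M _).symm
  have ha : a = ModelCyclotomes.intModEquiv (levelRigid C hC hS mods h15 L M) (intCompat C hC hS mods h15 L M b) :=
    (SemidirectProduct.inl_injective hb).symm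
  rw [rhoBLim_rigidLimEquiv, ha]
  have key : ModelCyclotomes.coeffAut (S := levelSetting C hC hS hl hp2 hpl hζ mods f hf M)
        (levelRigid C hC hS mods h15 L M) h218iM γ
        (ModelCyclotomes.intModEquiv (levelRigid C hC hS mods h15 L M) (intCompat C hC hS mods h15 L M b)) =
      ModelCyclotomes.intModEquiv (levelRigid C hC hS mods h15 L M)
        (intCompat C hC hS mods h15 L M (rhoALim C hC hS mods h15 L h218i₁ γ b)) := by
    rw [intCompat_rhoALim C hC hS hl hp2 hpl hζ mods f hf h15 L h218i₁ M h218iM γ b]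
    exact ModelCyclotomes.coeffAut_intModEquiv (S := levelSetting C hC hS hl hp2 hpl hζ mods f hf M)
      (levelRigid C hC hS mods h15 L M) h218iM γ _
  rw [key]
  exact coe_rigid_iso C hC hS hl hp2 hpl hζ mods f hf h15 L hZ M _


/-- **`ρ_B(γ)` IS THE ACTION OF THE LIFTS** ([EtTh] Cor. 2.18 (iv) / 2.19 (i), rows S10c/S10d): for every automorphism `α` of the
level-`M` model mono-theta environment `M(η)` lying over `γ` (on `Π^tp_{Y̲̲} ⊆ Π^tp_{X̲̲}`), the `M`-component of `ρ_B(γ) y` is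
`α` applied to the `M`-component of `y` — from `rhoBLim_level` and abc-iut-w5-d145's `iso_inMu_eq_coeffAut'` (which needs, BY NAME,
[EtTh] Cor. 2.19 (i) `Cor219_i_splittings` at level `M`). [cite: MochizukiEtTh2009, Cor 2.18(iv) p.61] -/
theorem rhoBLim_level_eq_iso (M : ℕ+) (h218iM : (levelRigid C hC hS mods h15 L M).Cor218_i)
    (h219M : (levelRigid C hC hS mods h15 L M).Cor219_i_splittings)
    {η : (levelData C hC hS mods M).PiYdd → (levelData C hC hS mods M).mu} (hη : η ∈ (levelData C hC hS mods M).thetaCocycles)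
    (α : ((levelData C hC hS mods M).modelMono hη).Iso ((levelData C hC hS mods M).modelMono hη))
    (γ : (levelRigid C hC hS mods h15 L 1).PiX ≃ₜ* (levelRigid C hC hS mods h15 L 1).PiX)
    (hαγ : ∀ x : (levelData C hC hS mods M).env,
      ((CycEnvelope.proj (levelData C hC hS mods M).augY (levelData C hC hS mods M).chi (α.e x) :
        (levelData C hC hS mods M).PiY) : ↥C.Huu) =
      γ ((CycEnvelope.proj (levelData C hC hS mods M).augY (levelData C hC hS mods M).chi x :
        (levelData C hC hS mods M).PiY) : ↥C.Huu))
    (y : ↥(modelSystem C hC hS hl hp2 hpl hζ mods f hf hmods h15 L hZ).extCycLim) (a : (levelData C hC hS mods M).mu)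
    (hy : (y : ∀ M', ((modelSystem C hC hS hl hp2 hpl hζ mods f hf hmods h15 L hZ).env M').Pi) M =
      (CycEnvelope.inMu (levelData C hC hS mods M).augY (levelData C hC hS mods M).chi a : (levelData C hC hS mods M).env)) :
    ((rhoBLim C hC hS hl hp2 hpl hζ mods f hf hmods h15 L hZ h218i₁ γ y :
        ↥(modelSystem C hC hS hl hp2 hpl hζ mods f hf hmods h15 L hZ).extCycLim) :
        ∀ M', ((modelSystem C hC hS hl hp2 hpl hζ mods f hf hmods h15 L hZ).env M').Pi) M =
      α.e ((y : ∀ M', ((modelSystem C hC hS hl hp2 hpl hζ mods f hf hmods h15 L hZ).env M').Pi) M) := by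
  rw [rhoBLim_level C hC hS hl hp2 hpl hζ mods f hf hmods h15 L hZ h218i₁ M h218iM γ y a hy, hy]
  exact (ModelCyclotomes.iso_inMu_eq_coeffAut' (S := levelSetting C hC hS hl hp2 hpl hζ mods f hf M)
    (levelRigid C hC hS mods h15 L M) h218iM h219M hη α γ hαγ a).symm

end Rho

/-! ## The base datum, the functorial family, and [IUTchII] Cor. 1.10 at the genuine natural system -/

section Datum

variable (h218i₁ : (levelRigid C hC hS mods h15 L 1).Cor218_i)

/-- `Π₀ := Π_X(𝕄_*) = Π^tp_{X̲̲}` as an isomorph of `Π^tp_{X̲̲_k}` (identity identification; the same object as the base point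
`⟨Π_X(𝕄_*), T.D.isoRef⟩` of abc-iut-w5-d145's `Models`, by proof irrelevance). [claim: Mochizuki2012, status: disputed] (IUTchII §1 Cor 1.10, kurims p.47) -/
def basePointLim : IsoClass (setting C hC hS hl hp2 hpl hζ mods f hf).PiX :=
  ⟨(modelSystem C hC hS hl hp2 hpl hζ mods f hf hmods h15 L hZ).PiX, ⟨ContinuousMulEquiv.refl _⟩⟩

/-- **The base datum of [IUTchII] Cor. 1.10 AT THE GENUINE NATURAL SYSTEM** (abc-iut-w5-d145's `MonoThetaBaseDatum`, all laws
PROVED; hypothesis: [EtTh] Cor. 2.18 (i) at level `1`, BY NAME): `A := (l·Δ_Θ)(𝕄_*)`, `B := Π_μ(𝕄_*)`, the descended conjugation /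
transported actions of `Π^tp_{X̲̲}`, `iso :=` THE limit cyclotomic rigidity isomorphism (∗mono-Θ) = `rigidLimHom` (bijective),
`ρ_A := rhoALim`, `ρ_B := rhoBLim` (= the level coefficient automorphisms, `rhoBLim_level`).
[claim: Mochizuki2012, status: disputed] (IUTchII §1 Cor 1.10, kurims p.47) -/
def baseDatumLim :
    MonoThetaBaseDatum (setting C hC hS hl hp2 hpl hζ mods f hf)
      (basePointLim C hC hS hl hp2 hpl hζ mods f hf hmods h15 L hZ) where
  A := intLim C hC hS mods h15 L hZ
  B := extLim C hC hS hl hp2 hpl hζ mods f hf hmods h15 L hZ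
  actA := actIntLim C hC hS mods h15 L
  actB := actExtLim C hC hS hl hp2 hpl hζ mods f hf hmods h15 L hZ
  iso := rigidLimEquiv C hC hS hl hp2 hpl hζ mods f hf hmods h15 L hZ
  equivariant x m := by
    change rigidLimEquiv C hC hS hl hp2 hpl hζ mods f hf hmods h15 L hZ (actIntLim C hC hS mods h15 L x m) =
      actExtLim C hC hS hl hp2 hpl hζ mods f hf hmods h15 L hZ x (rigidLimEquiv C hC hS hl hp2 hpl hζ mods f hf hmods h15 L hZ m)
    rw [actExtLim_apply, MulEquiv.symm_apply_apply]
  rhoA γ := rhoALim C hC hS mods h15 L h218i₁ γ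
  rhoB γ := rhoBLim C hC hS hl hp2 hpl hζ mods f hf hmods h15 L hZ h218i₁ γ
  rhoA_refl := rhoALim_refl C hC hS mods h15 L h218i₁
  rhoB_refl := rhoBLim_refl C hC hS hl hp2 hpl hζ mods f hf hmods h15 L hZ h218i₁
  rhoA_trans γ δ := rhoALim_trans C hC hS mods h15 L h218i₁ γ δ
  rhoB_trans γ δ := rhoBLim_trans C hC hS hl hp2 hpl hζ mods f hf hmods h15 L hZ h218i₁ γ δ
  rhoA_act γ x m := rhoALim_actIntLim C hC hS mods h15 L h218i₁ γ x m
  rhoB_act γ x m := rhoBLim_actExtLim C hC hS hl hp2 hpl hζ mods f hf hmods h15 L hZ h218i₁ γ x m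
  rho_comm γ m := (rhoBLim_rigidLimEquiv C hC hS hl hp2 hpl hζ mods f hf hmods h15 L hZ h218i₁ γ m).symm

/-- **The functorial family `Π ↦ ((l·Δ_Θ)(Π), Π_μ(M^Θ_*(Π)), (∗mono-Θ_Π))` of [IUTchII] Cor. 1.10 AT THE GENUINE NATURAL SYSTEM**
(abc-iut-w5-d145's `MonoThetaBaseDatum.family` of the base datum: constant modules, actions pulled back, transports
`ρ(e_Π⁻¹ ≫ f ≫ e_{Π*})`), modulo [EtTh] Cor. 2.18 (i). [claim: Mochizuki2012, status: disputed] (IUTchII §1 Cor 1.10, kurims p.47) -/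
def familyLim : MonoThetaRigidityData (setting C hC hS hl hp2 hpl hζ mods f hf) :=
  (baseDatumLim C hC hS hl hp2 hpl hζ mods f hf hmods h15 L hZ h218i₁).family

/-- **[IUTchII] Cor. 1.10 AT THE GENUINE NATURAL SYSTEM** (PROVED modulo [EtTh] Cor. 2.18 (i)): for the functor `ℛ → ℱ`
determined by `familyLim`, "the resulting natural functor `Ψ_ℛ : ℛ → ℛ†` is multiradially defined".
[claim: Mochizuki2012, status: disputed] (IUTchII §1 Cor 1.10, kurims p.47) -/
theorem cor110_multiradiallyDefined_modelLim (Γxμ : Type) [Group Γxμ] :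
    ((ex18iii (setting C hC hS hl hp2 hpl hζ mods f hf) Γxμ).toDagger
      (CategoryTheory.Prod.fst _ _ ⋙
        (familyLim C hC hS hl hp2 hpl hζ mods f hf hmods h15 L hZ h218i₁).toRigidityFunctor.Ξ)).IsMultiradiallyDefined :=
  (baseDatumLim C hC hS hl hp2 hpl hζ mods f hf hmods h15 L hZ h218i₁).cor110_multiradiallyDefined_ofBase Γxμ

/-- **IUTchII:Cor1.10, the junction C110-S10 AT THE GENUINE NATURAL SYSTEM (PROVED)**: the functorial family `familyLim` MODELS
(abc-iut-w5-d145's `MonoThetaRigidityData.Models`) the genuine output `((l·Δ_Θ)(𝕄_*), Π_μ(𝕄_*), rigidLim)` of [IUTchII] Props. 1.4 /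
1.5 (iii) — abc-iut-w4-d030's `θ_env` data `thetaEnvData` with the limit cyclotomic rigidity an isomorphism (`bijective_rigidLimHom`)
— carrying the pinned module structures `moduleStrLim`: by `MonoThetaBaseDatum.family_models` with the IDENTITY identifications
(the base datum IS the genuine output). Inputs BY NAME: [EtTh] Cor. 2.18 (i) at level `1` (`ρ_A`), its `Π^tp_{Ÿ}`-clause form
`PiYddCharacteristic C` (the Prop. 1.4 output), and the natural system's data (`Prop15iii`, `CuspLabels`, `hZ`).
[claim: Mochizuki2012, status: disputed] (IUTchII §1 Cor 1.10, kurims p.47) -/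
theorem familyLim_models :
    (familyLim C hC hS hl hp2 hpl hζ mods f hf hmods h15 L hZ h218i₁).Models
      (thetaEnvData C hC hS hl hp2 hpl hζ mods f hf hmods h15 L hZ hcharY
        (bijective_rigidLimHom C hC hS hl hp2 hpl hζ mods f hf hmods h15 L hZ))
      (moduleStrLim C hC hS hl hp2 hpl hζ mods f hf hmods h15 L hZ hcharY) :=
  MonoThetaBaseDatum.family_models _ _ (baseDatumLim C hC hS hl hp2 hpl hζ mods f hf hmods h15 L hZ h218i₁)
    (MulEquiv.refl _) (MulEquiv.refl _) (fun _ _ => rfl) (fun _ _ => rfl) (fun _ => rfl)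

end Datum

/-- **IUTchII:Cor1.10 / C110-S10 at the genuine natural system, NAMED-FACT form**: as `familyLim_models`, with the
`Π^tp_{Ÿ}`-clause input of the Prop. 1.4 output DERIVED from [EtTh] Cor. 2.18 (i) at level `1` (abc-iut-w4-d013's
`EtaleThetaDataOfSetting.piYddCharacteristic_of_cor218_i`) — so the junction holds modulo, BY NAME, the single level fact
`RigidData.Cor218_i` (F-0620 class) and the natural system's data inputs. [claim: Mochizuki2012, status: disputed] (IUTchII §1 Cor 1.10, kurims p.47) -/
theorem familyLim_models_of_cor218_i (h218i₁ : (levelRigid C hC hS mods h15 L 1).Cor218_i) :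
    (familyLim C hC hS hl hp2 hpl hζ mods f hf hmods h15 L hZ h218i₁).Models
      (thetaEnvData C hC hS hl hp2 hpl hζ mods f hf hmods h15 L hZ
        (EtaleThetaDataOfSetting.piYddCharacteristic_of_cor218_i C (mods 1) hC hS h15 L _ rfl h218i₁)
        (bijective_rigidLimHom C hC hS hl hp2 hpl hζ mods f hf hmods h15 L hZ))
      (moduleStrLim C hC hS hl hp2 hpl hζ mods f hf hmods h15 L hZ
        (EtaleThetaDataOfSetting.piYddCharacteristic_of_cor218_i C (mods 1) hC hS h15 L _ rfl h218i₁)) :=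
  familyLim_models C hC hS hl hp2 hpl hζ mods f hf hmods h15 L hZ _ h218i₁

end EtaleLevels

end Literature.IUT.HodgeArakelov
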